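import Mathlib.AlgebraicGeometry.Morphisms.FiniteType
import Mathlib.Topology.JacobsonSpace
import Literature.AlgebraicGeometry.Resolution.HilbertSamuelIsolatedSingularities
import Literature.AlgebraicGeometry.Resolution.HilbertSamuelSemicontinuitySharp
import Literature.AlgebraicGeometry.Resolution.HilbertSamuelGenericConstancyExcellent
import Literature.AlgebraicGeometry.Resolution.SigmaMaxEliminationInDim
import Literature.AlgebraicGeometry.Resolution.QuasiExcellentSchemes
import Literature.AlgebraicGeometry.Resolution.ExcellentRingsFieldProofs
import HarnessLib

/-!
# K4.2 over the tree's `Scheme.hsMaxLocus`: the first permissible step exists (rung L, slot W4.2)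

The kill test K4.2 of the cell `res-hironaka` (seat `res-L0-k42`, slot W4.2 "Hilbert–Samuel /
CJS home") asks, for two registered hypersurface specimens over `𝔽₂`, whether the
Hilbert–Samuel stratification behaves: **(P1)** finitely many values of `H^N_X` and a closed
Hilbert–Samuel locus `X_max`, **(P2)** a permissible centre (CJS Def. 3.1) inside `X_max`
exists. This file settles (P1) and (P2) in-Lean over the tree's typed vocabulary
(`Scheme.hsValues`, `Scheme.hsMaxLocus`, `IdealSheafData.IsPermissible`) for EVERY reduced
scheme of finite type over a field — in particular for both specimens and for every `X` in the
hypotheses of the route cruxes `SigmaMaxModifications` / `SigmaMaxModificationsDimGe4`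
(items stmt-ResolutionOfSingularities-18506 / -19250), whatever the characteristic:

* `maximalIdeal_not_mem_minimalPrimes_of_isReduced` — at a singular point of a reduced locally
  Noetherian scheme, `𝔪_x` is not a minimal prime of `𝒪_{X,x}` (else `𝒪_{X,x}` is a reduced
  zero-dimensional local ring, a field, hence regular);
* `isPermissible_vanishingIdeal_singleton` — so a closed singular point, with its reduced
  structure, is a permissible centre (CJS proof of Thm. 6.28, Step 1, reduced form);
* `firstCentre_over_field` — for `X → Spec k` locally of finite type and quasi-compact, `X`
  reduced and not regular, `dim X ≤ N`: `Σ^N_X` is finite, `X_max` is closed and non-empty, it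
  lies in `X ∖ Reg X`, and it contains a closed point `x` with `V(𝔪_x) = {x}` a permissible
  centre. Ingredients, all tree theorems: excellence of finite-type `k`-schemes
  (`Stacks07QW_field_holds`), CJS Thm. 2.33 / Lemma 2.36 on excellent schemes
  (`Scheme.finite_hsValues_of_isExcellent`, `Scheme.hsFun_le_hsFun_of_specializes_over_field`,
  `Scheme.isClosed_hsStratumGE_of_isExcellent`, `Scheme.isClosed_hsMaxLocus`),
  `X_max ⊆ X ∖ Reg X` (`Scheme.hsMaxLocus_subset_compl_regularLocus`), and Mathlib's Jacobson
  property of schemes locally of finite type over a field (closed points are dense in closed sets).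

This is the "first step of CJS Rem. 6.29 always exists" half of the test; the termination
question (the cruxes themselves) is untouched. Everything here is OURS; nothing is a statement
of, or attributed to, the manuscript under review. AI-produced; weaker than expert review.
-/

set_option linter.dupNamespace false -- mandated namespace of this single-conjunct summit

namespace Summit.ResolutionOfSingularities.ResolutionOfSingularities.Theorems.K42

open CategoryTheory AlgebraicGeometry TopologicalSpace IsLocalRing
open AlgebraicGeometry.Scheme.IdealSheafData
open Literature.AlgebraicGeometry.Resolution
open Literature.RingTheory.HilbertSamuel

universe u

variable {X : Scheme.{u}}

/-- **At a singular point of a reduced locally Noetherian scheme, `𝔪_x` is not a minimal prime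
of `𝒪_{X,x}`**: if it were, every prime of the local ring `𝒪_{X,x}` would equal `𝔪_x`, so
`𝔪_x = nil(𝒪_{X,x}) = 0` (reduced stalk), i.e. `𝒪_{X,x}` is a field — a regular local ring.
OURS (reduced form of the tree's integral-scheme lemma
`maximalIdeal_not_mem_minimalPrimes_of_not_mem_regularLocus`). [folklore] -/
theorem maximalIdeal_not_mem_minimalPrimes_of_isReduced [IsReduced X] [IsLocallyNoetherian X]
    {x : X} (hx : x ∉ Scheme.regularLocus X) :
    maximalIdeal (X.presheaf.stalk x) ∉ minimalPrimes (X.presheaf.stalk x) := by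
  intro h
  rw [minimalPrimes_eq_minimals] at h
  have hle : maximalIdeal (X.presheaf.stalk x) ≤ nilradical (X.presheaf.stalk x) := by
    rw [nilradical_eq_sInf]
    exact le_sInf fun J hJ => h.2 hJ (IsLocalRing.le_maximalIdeal (Ideal.IsPrime.ne_top hJ))
  have hbot : maximalIdeal (X.presheaf.stalk x) = ⊥ :=
    le_bot_iff.mp (hle.trans (nilradical_eq_zero (X.presheaf.stalk x)).le)
  refine hx (IsRegularLocalRing.of_spanFinrank_maximalIdeal_le _ ?_)
  rw [hbot, Submodule.spanFinrank_bot, Nat.cast_zero]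
  exact ringKrullDim_nonneg_of_nontrivial

/-- **A closed singular point of a reduced locally Noetherian scheme, with its reduced structure,
is a permissible centre** (CJS Def. 3.1 (2): a regular closed subscheme along which `X` is
normally flat and which contains no irreducible component of `X` — for `V(𝔪_x) = {x}` only the
last condition has content, and it is `maximalIdeal_not_mem_minimalPrimes_of_isReduced`).
OURS. [cite: CossartJannsenSaito2020, Def. 3.1 (2)] -/
theorem isPermissible_vanishingIdeal_singleton [IsReduced X] [IsLocallyNoetherian X] {x : X}
    (hcl : IsClosed ({x} : Set X)) (hx : x ∉ Scheme.regularLocus X) :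
    IdealSheafData.IsPermissible (vanishingIdeal (⟨{x}, hcl⟩ : Closeds X)) := by
  refine (isPermissible_vanishingIdeal_iff_of_finite (Z := ⟨{x}, hcl⟩) (Set.finite_singleton x)
    fun y hy => ?_).mpr fun y hy => ?_
  · rw [Closeds.coe_mk, Set.mem_singleton_iff] at hy
    rw [hy]
    exact hcl
  · rw [Closeds.coe_mk, Set.mem_singleton_iff] at hy
    subst hy
    exact maximalIdeal_not_mem_minimalPrimes_of_isReduced hx

/-- **(P1) ∧ (P2) of the kill test K4.2, for every reduced scheme of finite type over a field.**
Let `k` be a field, `f : X → Spec k` locally of finite type and quasi-compact, `X` reduced and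
not regular, and `dim X ≤ N`. Then: `Σ^N_X = {H^N_X(x)}` is finite (CJS Lemma 2.36 (b)); the
Hilbert–Samuel locus `X_max` (CJS Def. 2.35) is closed (Lemma 2.36 (a)), non-empty, and
contained in `X ∖ Reg X`; and `X_max` contains a closed point `x` such that `{x}` with its
reduced structure is a permissible centre (CJS Def. 3.1) — the first blow-up of CJS Rem. 6.29's
strategy is always available. OURS (assembly of tree theorems; replaces nothing in the
manuscript under review). [cite: CossartJannsenSaito2020, Lemma 2.36, Rem. 6.29] -/
theorem firstCentre_over_field {k : Type u} [Field k] (f : X ⟶ Spec (.of k))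
    [LocallyOfFiniteType f] [QuasiCompact f] [IsReduced X] (hX : ¬Scheme.IsRegular X) {N : ℕ}
    (hdim : topologicalKrullDim X ≤ (N : WithBot ℕ∞)) :
    (Scheme.hsValues X N).Finite ∧ IsClosed (Scheme.hsMaxLocus X N) ∧
      (Scheme.hsMaxLocus X N).Nonempty ∧ Scheme.hsMaxLocus X N ⊆ (Scheme.regularLocus X)ᶜ ∧
        ∃ (x : X) (hcl : IsClosed ({x} : Set X)), x ∈ Scheme.hsMaxLocus X N ∧
          IdealSheafData.IsPermissible (vanishingIdeal (⟨{x}, hcl⟩ : Closeds X)) := by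
  haveI : IsNoetherian X := Scheme.isNoetherian_of_finiteType_over_field f
  haveI : JacobsonSpace X := LocallyOfFiniteType.jacobsonSpace f
  have hexc : Scheme.IsExcellent X :=
    Scheme.isExcellent_of_locallyOfFiniteType Stacks07QW_field_holds f
  have hψ : ∀ x : X, Scheme.hsPsi X x ≤ N := Scheme.hsPsi_le_of_topologicalKrullDim_le hdim
  have hfin : (Scheme.hsValues X N).Finite := Scheme.finite_hsValues_of_isExcellent hexc N hψ
  -- CJS Thm. 2.33 (1) holds for every `N` over a field (sharp form), hence Thm. 2.33 (3)
  have h1 : ∀ x y : X, y ⤳ x → Scheme.hsFun X N y ≤ Scheme.hsFun X N x :=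
    fun x y h => Scheme.hsFun_le_hsFun_of_specializes_over_field f N h
  have husc : ∀ ν : ℕ → ℕ, IsClosed (Scheme.hsStratumGE X N ν) :=
    Scheme.isClosed_hsStratumGE_of_isExcellent hexc N hψ h1
  have hclosed : IsClosed (Scheme.hsMaxLocus X N) := Scheme.isClosed_hsMaxLocus husc hfin
  -- `X` is non-empty (the empty scheme is regular)
  haveI : Nonempty X := by
    by_contra hne
    exact hX fun x => (hne ⟨x⟩).elim
  have hne : (Scheme.hsMaxLocus X N).Nonempty := Scheme.hsMaxLocus_nonempty_of_finite hfin
  have hsub : Scheme.hsMaxLocus X N ⊆ (Scheme.regularLocus X)ᶜ :=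
    Scheme.hsMaxLocus_subset_compl_regularLocus
      (exists_ringKrullDim_stalk_eq_of_topologicalKrullDim_le hdim) hX
  -- a closed point of the closed non-empty set `X_max` (Jacobson property)
  obtain ⟨x, hxmax, hxcl⟩ := nonempty_inter_closedPoints hne hclosed.isLocallyClosed
  rw [mem_closedPoints_iff] at hxcl
  exact ⟨hfin, hclosed, hne, hsub, x, hxcl, hxmax,
    isPermissible_vanishingIdeal_singleton hxcl (hsub hxmax)⟩

end Summit.ResolutionOfSingularities.ResolutionOfSingularities.Theorems.K42
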